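import Mathlib
import Summits.Ventures.PercRepro2.SwOutCrossJunctionDefs

/-!
# The cross junction with THE MARK AT A DROPPED VERTEX: vocabulary (blind cell PercRepro2,
night-4 g26, 2026-08-28; proofs/NIGHT4-G26.md §3‴)

`CrossJunctionQ ends U h u p G o r`: the fields of `CrossJunction ends U h u p G o` with the
mark AT the dropped vertex `p r` (`hqr : o = p r`) in place of `hou`, `hop`; since `hout`
exempts the mark, the outside edge of `p r` is a field (`hext_r`).  The vocabulary of the class
partition (`uArmsX`, `farArmsX`, `crossForce`, `baseX`, `blockX`) is that of `SwOutCrossJunctionDefs`;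
the first consequences (`hou`, `hloop_p`, `exists_ext_edge`, `exists_clsExtX`, `exists_clsCX`,
`p_nbr`) are re-derived for the new structure.
-/

namespace Summit.Ventures.PercRepro2

namespace CrossArm

open Hull LocRows

variable {V : Type*} {E : Type*} [Fintype E] [DecidableEq E]

open scoped Classical

variable {ends : E → Sym2 V}

section Vocabulary

variable {X : Type*}

/-- **The cross junction with the mark at the dropped vertex `p r`**: the junction `u` and the
dropped vertices `p i` forming a component along the simple cross-edge graph `G`, the mark
`o = p r`, which carries an outside edge. -/
structure CrossJunctionQ (ends : E → Sym2 V) (U : Set V) (h u : V) (p : X → V)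
    (G : SimpleGraph X) (o : V) (r : X) : Prop where
  hne_hu : h ≠ u
  hne_hp : ∀ i, h ≠ p i
  hne_up : ∀ i, u ≠ p i
  p_inj : Function.Injective p
  /-- the mark is the dropped vertex `p r` -/
  hqr : o = p r
  /-- the mark carries an outside edge -/
  hext_r : ∃ e y, ends e = s(p r, y) ∧ y ∉ U ∧ y ≠ u ∧ ∀ j, y ≠ p j
  hhU : h ∈ U
  huU : u ∈ U
  hpU : ∀ i, p i ∈ U
  hloop_h : ∀ e, ends e ≠ s(h, h)
  hloop_u : ∀ e, ends e ≠ s(u, u)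
  hnadj : ∀ e, ends e ≠ s(h, u)
  hnadj_p : ∀ i e, ends e ≠ s(h, p i)
  hup : ∀ i, ∃ e, ends e = s(u, p i)
  /-- an edge for every edge of `G` -/
  hcross : ∀ i j, G.Adj i j → ∃ e, ends e = s(p i, p j)
  /-- a cross edge only along `G` -/
  hcross_adj : ∀ i j e, ends e = s(p i, p j) → G.Adj i j
  /-- the cross edges are simple -/
  hcross_simple : ∀ i j e e', ends e = s(p i, p j) → ends e' = s(p i, p j) → e = e'
  /-- (a) every neighbour of `u` other than the dropped vertices is adjacent to `h`. -/
  hu_adj_h : ∀ e x, ends e = s(u, x) → (∀ i, x ≠ p i) → ∃ e', ends e' = s(x, h)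
  /-- (b′) every neighbour of `p i` inside `U` is `u` or a dropped vertex. -/
  hp_in : ∀ i e x, ends e = s(p i, x) → x ∈ U → x = u ∨ ∃ j, x = p j
  hout : ∀ x ∈ U, x ≠ h → x ≠ o → x ≠ u →
    (∃ e y, ends e = s(x, y) ∧ y ∉ U) ∨ (∀ e, x ∉ ends e)

end Vocabulary

section Basic

variable {X : Type*} {U : Set V} {h u o : V} {p : X → V} {G : SimpleGraph X} {r : X}

variable (hj : CrossJunctionQ ends U h u p G o r)
include hj

omit [Fintype E] [DecidableEq E] in
/-- The mark is not the junction. -/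
lemma CrossJunctionQ.hou : o ≠ u := by
  rw [hj.hqr]
  exact (hj.hne_up r).symm

omit [Fintype E] [DecidableEq E] in
/-- The mark is not `h`. -/
lemma CrossJunctionQ.hoh : o ≠ h := by
  rw [hj.hqr]
  exact (hj.hne_hp r).symm

omit [Fintype E] [DecidableEq E] in
/-- No loop at a dropped vertex. -/
lemma CrossJunctionQ.hloop_p (i : X) (e : E) : ends e ≠ s(p i, p i) :=
  fun he => G.irrefl (hj.hcross_adj i i e he)

omit [Fintype E] [DecidableEq E] in
/-- A dropped vertex has an edge to the outside of `U` (the mark by `hext_r`, the others by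
`hout`). -/
lemma CrossJunctionQ.exists_ext_edge (i : X) :
    ∃ e y, ends e = s(p i, y) ∧ y ∉ U ∧ y ≠ u ∧ ∀ j, y ≠ p j := by
  by_cases hir : i = r
  · subst hir
    exact hj.hext_r
  · have hoi : o ≠ p i := by
      rw [hj.hqr]
      intro h'
      exact hir (hj.p_inj h').symm
    rcases hj.hout (p i) (hj.hpU i) (hj.hne_hp i).symm hoi.symm (hj.hne_up i).symm with
      ⟨e, y, hey, hyU⟩ | h'
    · exact ⟨e, y, hey, hyU, fun h' => hyU (h' ▸ hj.huU), fun j h' => hyU (h' ▸ hj.hpU j)⟩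
    · exfalso
      obtain ⟨e, he⟩ := hj.hup i
      exact h' e (by rw [he]; exact Sym2.mem_mk_right _ _)

omit [Fintype E] [DecidableEq E] in
/-- Every dropped vertex has an outside-class edge. -/
lemma CrossJunctionQ.exists_clsExtX (i : X) : ∃ e, e ∈ clsExtX ends u p i := by
  obtain ⟨e, y, hey, -, hyu, hyp⟩ := hj.exists_ext_edge i
  exact ⟨e, y, hey, hyu, hyp⟩

omit [Fintype E] [DecidableEq E] in
/-- Every edge of `G` has a cross-class edge. -/
lemma CrossJunctionQ.exists_clsCX (s : G.edgeSet) : ∃ e, e ∈ clsCX ends p G s := by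
  obtain ⟨s, hs⟩ := s
  induction s using Sym2.ind with
  | h i j =>
    obtain ⟨e, he⟩ := hj.hcross i j (G.mem_edgeSet.1 hs)
    exact ⟨e, i, j, rfl, he⟩

omit [Fintype E] [DecidableEq E] in
/-- A neighbour of a dropped vertex: `u`, an adjacent dropped vertex, or a vertex outside `U`. -/
lemma CrossJunctionQ.p_nbr {i : X} {e : E} {x : V} (he : ends e = s(p i, x)) :
    x = u ∨ (∃ j, x = p j ∧ G.Adj i j) ∨ x ∉ U := by
  by_cases hxU : x ∈ U
  · rcases hj.hp_in i e x he hxU with hxu | ⟨j, rfl⟩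
    · exact Or.inl hxu
    · exact Or.inr (Or.inl ⟨j, rfl, hj.hcross_adj i j e he⟩)
  · exact Or.inr (Or.inr hxU)

end Basic

end CrossArm

end Summit.Ventures.PercRepro2
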